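import Summits.SmoothPoincare4.SmoothPoincare4.Theorems.SymplecticOrigamiGromovRecognitionRelEndHelperTwoChartOfGlued
import Summits.SmoothPoincare4.SmoothPoincare4.Theorems.SymplecticOrigamiGromovRecognitionRelEndGluedBasics
import Summits.SmoothPoincare4.SmoothPoincare4.Theorems.SymplecticOrigamiGromovRecognitionRelEndEmbeddedLocalImage
import Literature.Geometry.Symplectic.PlusOneSpherePairProofs
import Literature.Geometry.Symplectic.JHolomorphicReparametrisation
import Literature.Geometry.Symplectic.AlmostComplexStructure
import Mathlib.LinearAlgebra.Determinant
import Mathlib.Analysis.Calculus.Deriv.Inv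
import Mathlib.Analysis.Calculus.ContDiff.Operations

/-!
# Möbius reparametrisation of a `J`-holomorphic two-chart sphere
(registered helper `helper_moebiusReparam` of line `cross-cap-laurent`, crux `GromovRecognitionRelEnd`,
item stmt-SmoothPoincare4-11009)

Setting: `X` an almost complex `4`-manifold (`JX` an almost complex structure), `(u, v)` a smooth
`JX`-holomorphic *two-chart sphere* (`u v : ℂ → X`, `v z = u z⁻¹` for `z ≠ 0`) with glued map
`F : C(ℂℙ¹, X)` (`F = u ∘ (w₁ / w₀)` on the chart `{w₀ ≠ 0}`, `F = v ∘ (w₀ / w₁)` on `{w₁ ≠ 0}`), and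
`A ∈ GL(2, ℂ)` with projective transformation (Möbius map) `σ_A = [v] ↦ [A v]` of `ℂℙ¹`.

Claim (`helper_moebiusReparam`, McDuff–Salamon 2012, §4.2: Möbius maps are biholomorphisms of the
Riemann sphere, so `F ∘ σ_A` is again a `J`-holomorphic sphere, embedded if `F` is): the
reparametrised map `G := F ∘ σ_A` is the glued map of a smooth `JX`-holomorphic two-chart sphere
`(u', v')`, namely `u' z := G [1 : z]`, `v' w := G [w : 1]`, and if `(u, v)` is embedded
(`u` an injective immersion, `v` immersive at `0`, `v 0 ∉ range u`) then so is `(u', v')`.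

Proof.  The two-chart bookkeeping (compatibility, the glued identities) is
`helper_twoChartOfGlued`.  Writing `a := A e₀`, `b := A e₁`, one has `u' z = F [a + z b]`; on the
open set `{a₀ + z b₀ ≠ 0}` this is `u ∘ μ` with the Möbius function
`μ z = (a₁ + z b₁) / (a₀ + z b₀)`, on `{a₁ + z b₁ ≠ 0}` it is `v ∘ (1 / μ)`, and the two sets cover
`ℂ` because `det A = a₀ b₁ - a₁ b₀ ≠ 0`; `μ` and `1 / μ` are holomorphic there with derivative
`± det A / (…)² ≠ 0`.  Smoothness, `J`-holomorphicity (chain rule, the real derivative of a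
holomorphic function is complex linear; Hummel 1997, Ch. I §3) and immersivity are local, so they
transfer from `u`, `v` to `u'`; the same computation with `a`, `b` exchanged handles
`v' w = F [b + w a]`.  Finally `F` is injective on `ℂℙ¹` when `u` is injective and `v 0 ∉ range u`
(the only point off the chart `{w₀ ≠ 0}` is `[0 : 1] ↦ v 0`;
`EmbeddedLocalImage.locImg_glued_injective`), `σ_A` is bijective, so `G` is injective, whence `u'`
is injective and `v' 0 = G [0 : 1] ∉ range u' = G {[1 : z]}`.

References: D. McDuff, D. Salamon, *J-holomorphic Curves and Symplectic Topology*, 2nd ed. (2012),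
§4.2; C. Hummel, *Gromov's Compactness Theorem for Pseudo-holomorphic Curves* (1997), Ch. I §3;
P. Griffiths, J. Harris, *Principles of Algebraic Geometry* (1978), Ch. 0 §2.  No new definitions,
notation or instances.
-/

noncomputable section

-- the prescribed namespace `Summit.<P>.<Sub>.…` duplicates `SmoothPoincare4` (P = Sub)
set_option linter.dupNamespace false

open scoped Manifold ContDiff Topology
open Set Function Filter
open Literature.Topology.FourManifolds Literature.Topology.FourManifolds.ComplexProjectiveSpace
open Literature.Geometry.Symplectic

namespace Summit.SmoothPoincare4.SmoothPoincare4.Theorems.GromovRecognitionRelEnd.CrossCapLaurent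

namespace MoebiusReparam

/-! ### Local holomorphic reparametrisation of a `J`-holomorphic map -/

section LocalComp

variable {E : Type*} [NormedAddCommGroup E] [NormedSpace ℝ E] {H : Type*} [TopologicalSpace H]
  {I : ModelWithCorners ℝ E H} {M : Type*} [TopologicalSpace M] [ChartedSpace H M]
  {J : ∀ x : M, TangentSpace I x →L[ℝ] TangentSpace I x}

/-- **Local holomorphic reparametrisation.**  Let `g : ℂ → M` be `C^∞` and `J`-holomorphic and let
`Φ` agree near `z` with `g ∘ μ`, `μ` complex-smooth at `z` with `μ' z = d ≠ 0`.  Then `Φ` is `C^∞`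
at `z`, `dΦ_z (i ζ) = J (dΦ_z ζ)` (chain rule: `dΦ_z = dg_{μ z} ∘ (ζ ↦ ζ d)` and `(i ζ) d = i (ζ d)`),
and `dΦ_z` is injective if `dg_{μ z}` is (Hummel 1997, Ch. I §3: pseudo-holomorphic maps compose
with holomorphic maps of the source). [cite: Hummel1997, Ch. I §3, Definition and eq. (3.1)] -/
theorem local_comp {g : ℂ → M} (hg : ContMDiff 𝓘(ℝ, ℂ) I ∞ g) (hJ : IsJHolomorphic I J g)
    {Φ : ℂ → M} {μ : ℂ → ℂ} {z d : ℂ} (hμ : ContDiffAt ℂ ∞ μ z) (hd : HasDerivAt μ d z)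
    (hd0 : d ≠ 0) (heq : Φ =ᶠ[𝓝 z] g ∘ μ) :
    ContMDiffAt 𝓘(ℝ, ℂ) I ∞ Φ z ∧
      (∀ ζ : ℂ, mfderiv 𝓘(ℝ, ℂ) I Φ z (Complex.I * ζ : ℂ) =
        J (Φ z) (mfderiv 𝓘(ℝ, ℂ) I Φ z (ζ : ℂ))) ∧
      (Injective (mfderiv 𝓘(ℝ, ℂ) I g (μ z)) → Injective (mfderiv 𝓘(ℝ, ℂ) I Φ z)) := by
  have hμm : ContMDiffAt 𝓘(ℝ, ℂ) 𝓘(ℝ, ℂ) ∞ μ z :=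
    contMDiffAt_iff_contDiffAt.2 (hμ.restrict_scalars ℝ)
  -- the real derivative of `μ` at `z` is multiplication by `d`
  set L : ℂ →L[ℝ] ℂ := (ContinuousLinearMap.smulRight (1 : ℂ →L[ℂ] ℂ) d).restrictScalars ℝ
    with hL
  have hLapply : ∀ ζ : ℂ, L ζ = ζ * d := fun ζ => by
    simp [hL]
  have hμd : HasMFDerivAt 𝓘(ℝ, ℂ) 𝓘(ℝ, ℂ) μ z L :=
    (hd.hasFDerivAt.restrictScalars ℝ).hasMFDerivAt
  have hgd : MDifferentiableAt 𝓘(ℝ, ℂ) I g (μ z) :=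
    (hg (μ z)).mdifferentiableAt (by simp)
  have hLinj : Injective L := fun ζ₁ ζ₂ h => by
    rw [hLapply, hLapply] at h
    exact mul_right_cancel₀ hd0 h
  have hderiv : mfderiv 𝓘(ℝ, ℂ) I (g ∘ μ) z = (mfderiv 𝓘(ℝ, ℂ) I g (μ z)).comp L :=
    (hgd.hasMFDerivAt.comp z hμd).mfderiv
  -- the statements for `g ∘ μ`
  have h2 : ∀ ζ : ℂ, mfderiv 𝓘(ℝ, ℂ) I (g ∘ μ) z (Complex.I * ζ : ℂ) =
      J (g (μ z)) (mfderiv 𝓘(ℝ, ℂ) I (g ∘ μ) z (ζ : ℂ)) := by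
    intro ζ
    rw [hderiv]
    calc ((mfderiv 𝓘(ℝ, ℂ) I g (μ z)).comp L) (Complex.I * ζ)
          = mfderiv 𝓘(ℝ, ℂ) I g (μ z) (L (Complex.I * ζ)) := rfl
      _ = mfderiv 𝓘(ℝ, ℂ) I g (μ z) (Complex.I * (ζ * d)) := by rw [hLapply, mul_assoc]
      _ = J (g (μ z)) (mfderiv 𝓘(ℝ, ℂ) I g (μ z) (ζ * d)) := hJ (μ z) _
      _ = J (g (μ z)) (mfderiv 𝓘(ℝ, ℂ) I g (μ z) (L ζ)) := by rw [hLapply]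
      _ = J (g (μ z)) (((mfderiv 𝓘(ℝ, ℂ) I g (μ z)).comp L) ζ) := rfl
  have h3 : Injective (mfderiv 𝓘(ℝ, ℂ) I g (μ z)) →
      Injective (mfderiv 𝓘(ℝ, ℂ) I (g ∘ μ) z) := by
    intro hinj
    rw [hderiv]
    show Injective (⇑(mfderiv 𝓘(ℝ, ℂ) I g (μ z)) ∘ ⇑L)
    exact hinj.comp hLinj
  -- transfer to `Φ`
  refine ⟨((hg (μ z)).comp z hμm).congr_of_eventuallyEq heq, fun ζ => ?_, fun hinj => ?_⟩
  · rw [heq.mfderiv_eq, heq.eq_of_nhds]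
    exact h2 ζ
  · rw [heq.mfderiv_eq]
    exact h3 hinj

end LocalComp

/-! ### The chart maps `z ↦ F [a + z b]` of a reparametrised glued map -/

section ChartMap

variable {E : Type*} [NormedAddCommGroup E] [NormedSpace ℝ E] {H : Type*} [TopologicalSpace H]
  {I : ModelWithCorners ℝ E H} {M : Type*} [TopologicalSpace M] [ChartedSpace H M]
  {J : ∀ x : M, TangentSpace I x →L[ℝ] TangentSpace I x}
  {u v : ℂ → M} {F : ComplexProjectiveSpace 1 → M}

/-- **The chart maps of a Möbius-reparametrised sphere.**  Let `F : ℂℙ¹ → M` be glued from the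
`C^∞` `J`-holomorphic pair `(u, v)` and let `a b ∈ ℂ²` have `a₀ b₁ - a₁ b₀ ≠ 0`.  Then
`Φ z := F [a + z b]` is `C^∞` and `J`-holomorphic, and immersive wherever `u` is immersive and `v`
is immersive at `0`: on `{a₀ + z b₀ ≠ 0}` it is `u ∘ μ`, `μ = (a₁ + z b₁) / (a₀ + z b₀)`, on
`{a₁ + z b₁ ≠ 0}` it is `v ∘ (1 / μ)` (where `1 / μ` vanishes exactly off the first set), the two
sets cover `ℂ`, and `μ' = (a₀ b₁ - a₁ b₀) / (a₀ + z b₀)² ≠ 0` (McDuff–Salamon 2012, §4.2).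
[cite: McDuffSalamon2012, §4.2] -/
theorem chartMap_smooth_jHolomorphic_immersive
    (hu : ContMDiff 𝓘(ℝ, ℂ) I ∞ u) (hv : ContMDiff 𝓘(ℝ, ℂ) I ∞ v)
    (hJu : IsJHolomorphic I J u) (hJv : IsJHolomorphic I J v)
    (hF0 : ∀ p, CoordNeZero 0 p → F p = u (affineCoordComplex 0 p 0))
    (hF1 : ∀ p, CoordNeZero 1 p → F p = v (affineCoordComplex 1 p 0))
    {a b : Fin (1 + 1) → ℂ} (hdet : a 0 * b 1 - a 1 * b 0 ≠ 0) {Φ : ℂ → M}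
    (hΦ : ∀ z : ℂ, ∃ w : {w : Fin (1 + 1) → ℂ // w ≠ 0},
      (w : Fin (1 + 1) → ℂ) = a + z • b ∧ Φ z = F (mk w)) :
    ContMDiff 𝓘(ℝ, ℂ) I ∞ Φ ∧ IsJHolomorphic I J Φ ∧
      ((∀ z, Injective (mfderiv 𝓘(ℝ, ℂ) I u z)) → Injective (mfderiv 𝓘(ℝ, ℂ) I v 0) →
        ∀ z, Injective (mfderiv 𝓘(ℝ, ℂ) I Φ z)) := by
  -- the two homogeneous coordinates of `a + z b`, affine-linear in `z`
  set p : ℂ → ℂ := fun z => a 0 + z * b 0 with hp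
  set q : ℂ → ℂ := fun z => a 1 + z * b 1 with hq
  have hw0 : ∀ z : ℂ, (a + z • b) 0 = p z := fun z => by simp [hp]
  have hw1 : ∀ z : ℂ, (a + z • b) 1 = q z := fun z => by simp [hq]
  -- `Φ` read in the two charts
  have h0 : ∀ z, p z ≠ 0 → Φ z = u (q z / p z) := by
    intro z hz
    obtain ⟨w, hw, hΦz⟩ := hΦ z
    have hc : CoordNeZero 0 (mk w) := by
      rw [coordNeZero_mk, hw, hw0]
      exact hz
    rw [hΦz, hF0 _ hc, GluedBasics.affineCoordComplex_zero_mk, hw, hw0, hw1]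
  have h1 : ∀ z, q z ≠ 0 → Φ z = v (p z / q z) := by
    intro z hz
    obtain ⟨w, hw, hΦz⟩ := hΦ z
    have hc : CoordNeZero 1 (mk w) := by
      rw [coordNeZero_mk, hw, hw1]
      exact hz
    rw [hΦz, hF1 _ hc, GluedBasics.affineCoordComplex_one_mk, hw, hw0, hw1]
  -- the two charts cover `ℂ`: `p z = 0 = q z` contradicts `a₀ b₁ - a₁ b₀ ≠ 0`
  have hcover : ∀ z, p z = 0 → q z ≠ 0 := by
    intro z hpz hqz
    have hpz' : a 0 + z * b 0 = 0 := hpz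
    have hqz' : a 1 + z * b 1 = 0 := hqz
    exact hdet (by linear_combination b 1 * hpz' - b 0 * hqz')
  -- calculus of `p` and `q`
  have hpc : Continuous p := by simp only [hp]; fun_prop
  have hqc : Continuous q := by simp only [hq]; fun_prop
  have hps : ContDiff ℂ ∞ p := by simp only [hp]; fun_prop
  have hqs : ContDiff ℂ ∞ q := by simp only [hq]; fun_prop
  have hpd : ∀ z, HasDerivAt p (b 0) z := fun z => by
    simpa [hp] using ((hasDerivAt_id z).mul_const (b 0)).const_add (a 0)
  have hqd : ∀ z, HasDerivAt q (b 1) z := fun z => by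
    simpa [hq] using ((hasDerivAt_id z).mul_const (b 1)).const_add (a 1)
  -- chart `0`: near a point with `p z ≠ 0`, `Φ = u ∘ (q / p)`
  have loc0 : ∀ z, p z ≠ 0 → ContMDiffAt 𝓘(ℝ, ℂ) I ∞ Φ z ∧
      (∀ ζ : ℂ, mfderiv 𝓘(ℝ, ℂ) I Φ z (Complex.I * ζ : ℂ) =
        J (Φ z) (mfderiv 𝓘(ℝ, ℂ) I Φ z (ζ : ℂ))) ∧
      (Injective (mfderiv 𝓘(ℝ, ℂ) I u (q z / p z)) → Injective (mfderiv 𝓘(ℝ, ℂ) I Φ z)) := by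
    intro z hz
    have heq : Φ =ᶠ[𝓝 z] u ∘ fun z => q z / p z :=
      (hpc.continuousAt.eventually_ne hz).mono fun z' hz' => h0 z' hz'
    have hnum : b 1 * p z - q z * b 0 = a 0 * b 1 - a 1 * b 0 := by
      simp only [hp, hq]; ring
    exact local_comp hu hJu (hqs.contDiffAt.div hps.contDiffAt hz) ((hqd z).div (hpd z) hz)
      (div_ne_zero (hnum ▸ hdet) (pow_ne_zero 2 hz)) heq
  -- chart `1`: near a point with `q z ≠ 0`, `Φ = v ∘ (p / q)`
  have loc1 : ∀ z, q z ≠ 0 → ContMDiffAt 𝓘(ℝ, ℂ) I ∞ Φ z ∧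
      (∀ ζ : ℂ, mfderiv 𝓘(ℝ, ℂ) I Φ z (Complex.I * ζ : ℂ) =
        J (Φ z) (mfderiv 𝓘(ℝ, ℂ) I Φ z (ζ : ℂ))) ∧
      (Injective (mfderiv 𝓘(ℝ, ℂ) I v (p z / q z)) → Injective (mfderiv 𝓘(ℝ, ℂ) I Φ z)) := by
    intro z hz
    have heq : Φ =ᶠ[𝓝 z] v ∘ fun z => p z / q z :=
      (hqc.continuousAt.eventually_ne hz).mono fun z' hz' => h1 z' hz'
    have hnum : b 0 * q z - p z * b 1 = -(a 0 * b 1 - a 1 * b 0) := by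
      simp only [hp, hq]; ring
    exact local_comp hv hJv (hps.contDiffAt.div hqs.contDiffAt hz) ((hpd z).div (hqd z) hz)
      (div_ne_zero (hnum ▸ neg_ne_zero.2 hdet) (pow_ne_zero 2 hz)) heq
  refine ⟨fun z => ?_, fun z ζ => ?_, fun himm_u himm_v z => ?_⟩
  · by_cases hz : p z = 0
    · exact (loc1 z (hcover z hz)).1
    · exact (loc0 z hz).1
  · by_cases hz : p z = 0
    · exact (loc1 z (hcover z hz)).2.1 ζ
    · exact (loc0 z hz).2.1 ζ
  · by_cases hz : p z = 0
    · refine (loc1 z (hcover z hz)).2.2 ?_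
      rw [hz, zero_div]
      exact himm_v
    · exact (loc0 z hz).2.2 (himm_u _)

end ChartMap

/-! ### Linear algebra of `ℂ²` and the points `[1 : z]`, `[w : 1]` -/

/-- For `A ∈ GL(2, ℂ)` the columns `a = A e₀`, `b = A e₁` have `a₀ b₁ - a₁ b₀ = det A ≠ 0`.
[folklore] -/
theorem det_columns_ne_zero (A : (Fin 2 → ℂ) ≃ₗ[ℂ] (Fin 2 → ℂ)) :
    A (Pi.single 0 1) 0 * A (Pi.single 1 1) 1 - A (Pi.single 0 1) 1 * A (Pi.single 1 1) 0 ≠ 0 := by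
  have h := (LinearEquiv.isUnit_det' A).ne_zero
  rw [← LinearMap.det_toMatrix (Pi.basisFun ℂ (Fin 2)), Matrix.det_fin_two] at h
  simp only [LinearMap.toMatrix_apply, Pi.basisFun_apply, Pi.basisFun_repr,
    LinearEquiv.coe_coe] at h
  intro h'
  exact h (by linear_combination h')

/-- Homogeneous coordinates of `[1 : z]`: `(1, z) = e₀ + z e₁`. [folklore] -/
theorem coe_homogenize_zero (z : ℂ) :
    ((homogenize 0 fun _ : Fin 1 => z : {w : Fin (1 + 1) → ℂ // w ≠ 0}) : Fin (1 + 1) → ℂ) =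
      Pi.single 0 1 + z • Pi.single 1 1 := by
  funext j
  rcases Fin.exists_fin_two.1 ⟨j, rfl⟩ with rfl | rfl
  · simp [homogenize]
  · simp [homogenize]

/-- Homogeneous coordinates of `[w : 1]`: `(w, 1) = e₁ + w e₀`. [folklore] -/
theorem coe_homogenize_one (w : ℂ) :
    ((homogenize 1 fun _ : Fin 1 => w : {w : Fin (1 + 1) → ℂ // w ≠ 0}) : Fin (1 + 1) → ℂ) =
      Pi.single 1 1 + w • Pi.single 0 1 := by
  funext j
  rcases Fin.exists_fin_two.1 ⟨j, rfl⟩ with rfl | rfl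
  · simp [homogenize]
    rfl
  · simp [homogenize]

end MoebiusReparam

open MoebiusReparam

/-- **Möbius reparametrisation of a (embedded) `J`-two-chart sphere is a (embedded) `J`-two-chart
sphere** (registered stub `helper_moebiusReparam` of line `cross-cap-laurent`, signature verbatim).
For the glued map `F : ℂℙ¹ → X` of a smooth `JX`-holomorphic two-chart sphere `(u, v)` and
`A ∈ GL(2, ℂ)`, the reparametrised map `G = F ∘ [A]` is the glued map of the smooth
`JX`-holomorphic two-chart sphere `u' z := G [1 : z]`, `v' w := G [w : 1]`; and if `u` is an
injective immersion, `v` is immersive at `0` and `v 0 ∉ range u`, the same holds for `(u', v')`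
(Möbius maps are biholomorphisms of the Riemann sphere; McDuff–Salamon 2012, §4.2).
[cite: McDuffSalamon2012, §4.2] -/
theorem helper_moebiusReparam : ∀ (X : Type) [TopologicalSpace X] [T2Space X] [SecondCountableTopology X] [ChartedSpace (EuclideanSpace ℝ (Fin 4)) X] [IsManifold (𝓡 4) ∞ X] (JX : Literature.Geometry.Symplectic.AlmostComplexStructure (𝓡 4) ∞ X) (u v : ℂ → X) (F : C(Literature.Topology.FourManifolds.ComplexProjectiveSpace 1, X)) (A : (Fin 2 → ℂ) ≃ₗ[ℂ] (Fin 2 → ℂ)), ContMDiff 𝓘(ℝ, ℂ) (𝓡 4) ∞ u → ContMDiff 𝓘(ℝ, ℂ) (𝓡 4) ∞ v → (∀ z : ℂ, z ≠ 0 → v z = u z⁻¹) → Literature.Geometry.Symplectic.IsJHolomorphic (𝓡 4) (fun y => JX y) u → Literature.Geometry.Symplectic.IsJHolomorphic (𝓡 4) (fun y => JX y) v → (∀ p, Literature.Topology.FourManifolds.ComplexProjectiveSpace.CoordNeZero 0 p → F p = u (Literature.Topology.FourManifolds.ComplexProjectiveSpace.affineCoordComplex 0 p 0)) → (∀ p,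 Literature.Topology.FourManifolds.ComplexProjectiveSpace.CoordNeZero 1 p → F p = v (Literature.Topology.FourManifolds.ComplexProjectiveSpace.affineCoordComplex 1 p 0)) → ∃ u' v' : ℂ → X, ContMDiff 𝓘(ℝ, ℂ) (𝓡 4) ∞ u' ∧ ContMDiff 𝓘(ℝ, ℂ) (𝓡 4) ∞ v' ∧ (∀ z : ℂ, z ≠ 0 → v' z = u' z⁻¹) ∧ Literature.Geometry.Symplectic.IsJHolomorphic (𝓡 4) (fun y => JX y) u' ∧ Literature.Geometry.Symplectic.IsJHolomorphic (𝓡 4) (fun y => JX y) v' ∧ (∀ p, Literature.Topology.FourManifolds.ComplexProjectiveSpace.CoordNeZero 0 p → (F.comp ⟨Literature.Geometry.Symplectic.PlusOneSpherePair.projectiveMap A, Literature.Geometry.Symplectic.PlusOneSpherePair.continuous_projectiveMap A⟩) p = u' (Literature.Topology.FourManifolds.ComplexProjectiveSpace.affineCoordComplex 0 p 0)) ∧ (∀ p, Literature.Topology.FourManifolds.ComplexProjectiveSpace.CoordNeZero 1 p → (F.comp ⟨Literature.Geometry.Symplectic.PlusOneSpherePair.projectiveMap A, Literature.Geometry.Symplectic.PlusOneSpherePair.continuous_projectiveMap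 A⟩) p = v' (Literature.Topology.FourManifolds.ComplexProjectiveSpace.affineCoordComplex 1 p 0)) ∧ ((Function.Injective u ∧ (∀ z, Function.Injective (mfderiv 𝓘(ℝ, ℂ) (𝓡 4) u z)) ∧ Function.Injective (mfderiv 𝓘(ℝ, ℂ) (𝓡 4) v 0) ∧ v 0 ∉ Set.range u) → (Function.Injective u' ∧ (∀ z, Function.Injective (mfderiv 𝓘(ℝ, ℂ) (𝓡 4) u' z)) ∧ Function.Injective (mfderiv 𝓘(ℝ, ℂ) (𝓡 4) v' 0) ∧ v' 0 ∉ Set.range u')) := by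
  intro X _ _ _ _ _ JX u v F A hu hv _huv hJu hJv hF0 hF1
  -- the reparametrised glued map `G = F ∘ [A]` and its two chart maps
  set G : C(ComplexProjectiveSpace 1, X) :=
    F.comp ⟨PlusOneSpherePair.projectiveMap A, PlusOneSpherePair.continuous_projectiveMap A⟩
    with hG
  set u' : ℂ → X := fun z =>
    G ((affineChart (n := 1) 0).symm (realCoordinates 1 fun _ : Fin 1 => z))
  set v' : ℂ → X := fun w =>
    G ((affineChart (n := 1) 1).symm (realCoordinates 1 fun _ : Fin 1 => w))
  obtain ⟨hc, hg0, hg1, -, -⟩ := helper_twoChartOfGlued X G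
  -- the columns of `A`
  set a : Fin (1 + 1) → ℂ := A (Pi.single 0 1)
  set b : Fin (1 + 1) → ℂ := A (Pi.single 1 1)
  have hdet : a 0 * b 1 - a 1 * b 0 ≠ 0 := det_columns_ne_zero A
  have hdet' : b 0 * a 1 - b 1 * a 0 ≠ 0 := fun h => hdet (by linear_combination -h)
  -- `u' z = F [a + z b]` and `v' w = F [b + w a]`
  have hΦu : ∀ z : ℂ, ∃ w : {w : Fin (1 + 1) → ℂ // w ≠ 0},
      (w : Fin (1 + 1) → ℂ) = a + z • b ∧ u' z = F (mk w) := by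
    intro z
    refine ⟨⟨A (homogenize 0 fun _ : Fin 1 => z),
      A.map_ne_zero_iff.2 (homogenize 0 fun _ : Fin 1 => z).2⟩, ?_, ?_⟩
    · show A (homogenize 0 fun _ : Fin 1 => z) = a + z • b
      rw [coe_homogenize_zero, map_add, map_smul]
    · show F (PlusOneSpherePair.projectiveMap A (mk (homogenize 0
        ((realCoordinates 1).symm (realCoordinates 1 fun _ : Fin 1 => z))))) = _
      rw [ContinuousLinearEquiv.symm_apply_apply]
      rfl
  have hΦv : ∀ w : ℂ, ∃ x : {x : Fin (1 + 1) → ℂ // x ≠ 0},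
      (x : Fin (1 + 1) → ℂ) = b + w • a ∧ v' w = F (mk x) := by
    intro w
    refine ⟨⟨A (homogenize 1 fun _ : Fin 1 => w),
      A.map_ne_zero_iff.2 (homogenize 1 fun _ : Fin 1 => w).2⟩, ?_, ?_⟩
    · show A (homogenize 1 fun _ : Fin 1 => w) = b + w • a
      rw [coe_homogenize_one, map_add, map_smul]
    · show F (PlusOneSpherePair.projectiveMap A (mk (homogenize 1
        ((realCoordinates 1).symm (realCoordinates 1 fun _ : Fin 1 => w))))) = _
      rw [ContinuousLinearEquiv.symm_apply_apply]
      rfl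
  obtain ⟨hu's, hJu', himm_u'⟩ :=
    chartMap_smooth_jHolomorphic_immersive hu hv hJu hJv hF0 hF1 hdet hΦu
  obtain ⟨hv's, hJv', himm_v'⟩ :=
    chartMap_smooth_jHolomorphic_immersive hu hv hJu hJv hF0 hF1 hdet' hΦv
  refine ⟨u', v', hu's, hv's, hc, hJu', hJv', hg0, hg1, ?_⟩
  -- embeddedness transfers
  rintro ⟨hinj, himm_u, himm_v, hnot⟩
  have hGinj : Injective G := by
    rw [hG, ContinuousMap.coe_comp, ContinuousMap.coe_mk]
    exact (EmbeddedLocalImage.locImg_glued_injective hF0 hF1 hinj hnot).comp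
      (LeftInverse.injective (PlusOneSpherePair.projectiveMap_symm_apply A))
  refine ⟨fun z₁ z₂ h => ?_, himm_u' himm_u himm_v, himm_v' himm_u himm_v 0, ?_⟩
  · have h' := hGinj h
    rw [← affineCoordComplex_affineChart_symm 0 z₁, h', affineCoordComplex_affineChart_symm]
  · rintro ⟨z, hz⟩
    have h' := hGinj hz
    have h0 := coordNeZero_affineChart_symm (n := 1) 0 (realCoordinates 1 fun _ : Fin 1 => z)
    rw [h'] at h0
    exact not_coordNeZero_zero_affineChart_one_symm h0

end Summit.SmoothPoincare4.SmoothPoincare4.Theorems.GromovRecognitionRelEnd.CrossCapLaurent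

end
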